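import Literature.NumberTheory.Rogawski1990.ArchTransfersSingularOfCanonical     -- ★ `stub_Sc`'s text (`ArchTransfersSingularOfCanonical(Closed)`), brings ★ #77 `ArchTransfersExistCanonical`, ★ #77-s `…Singular`, ★ (S-d) `ArchCentralValueTransfer(Exists)(Closed)`
import Literature.NumberTheory.Rogawski1990.ArchCentralValueTransferExistsVacuous  -- ★ p06 (g9): the vacuous frames of (S-d) (`archCentralValueTransferExists_of_not_*`)
import Literature.NumberTheory.Rogawski1990.ArchCentralValueTransferDiagonalOfLetter -- ★ p842658 (SdArch ED. 3 assembly, F0P3a-p03 (g11)): `archCentralValueTransferExists_canonical_of_letter` — (S-d) from the (L_{U(2,1)}) letter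
import Literature.NumberTheory.Rogawski1990.ArchDeltaTransferCentralVanishing     -- ★ p841993 (3Z, F0P3a-p03 (g11)): `archDeltaTransfer_apply_center_eq_zero` — `stub_ScCore` PAID (ED. 2)
import Literature.NumberTheory.Rogawski1990.ArchCentralLimitFormulaOfExistsLetter -- ★ p846458 (F0P3a-p09 (g2)): `archCentralLimitFormulaRankTwo_of_archCentralLimitExists_of_core` — the letter from (A6′) + `hcore`; brings ★ p846449 (A6′) def `ArchCentralLimitExists` (`stub_A6lim`'s text), ★ p846447∕p846436, ★ (G′)∕(o4)∕(o4′)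
import Literature.NumberTheory.Rogawski1990.ArchCentralLimitCornerRegularityOfJetBounds -- ★ p846672 (F0P3a-p09 (g2)): `archCentralLimitExists_of_liePhiJetBounds` — (A6-lim) at every frame from Harish-Chandra's chamber jet bounds `hball` ALONE (★ Whitney convex + ★ closure lemma + ★ (f1) p846633 + the ED. 5 body)
import Literature.Geometry.ComplexHyperbolic.UnitBallLieAlgebraChamberJets       -- ★ p846680 ((d2) FILE 3b, ROAD A owner F0P3a-p05 (g15)): `liePhi_chamberJetBounds` — the `hball` packager VERBATIM (bounded jets of `liePhi μ f` of every order on every chamber piece `C_σ ∩ B(0,1∕4)`)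
import Literature.Geometry.ComplexHyperbolic.UnitBallCentreValueOfRayIdentity     -- ★ p845507 (F0P3a-p02 (g14), W6-FINAL): `ballCore_of_rayIdentity` — `hcore` from the pointwise ray identity
import Literature.Geometry.ComplexHyperbolic.UnitBallCentreValueRayIdentity  -- ★ p846302: `rayIdentity_of_total` — the pointwise ray identity (p06 TOTAL ★ p845494 + p09 χ∕ψ token bridges)
import HarnessLib

/-!
# LINE CANDIDATE «SdArch» (SKETCH, HOME-only; not registered) — the archimedean pay-down of the closer's ROAD-Sd stubs `stub_Sc` ∕ `stub_Sd` of `F0_U3LettersRung1`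
# as `stub_*` RESIDUALS + `_of` assemblies BY NAME (F0P3a-p02 (g10), LEAD WORD T8-50 (A); companion md `LEDGER-ROAD-Sd.v2.F0P3a-p02g10.md`)

EDITION 2 («ScCore PAID», F0P3a-p03 (g11), LEAD WORDS T8-113 LINK 3 ∕ T8-115 (b)): `stub_ScCore` is no longer `sorry` — its body is ★ `archDeltaTransfer_apply_center_eq_zero`
(`Literature/NumberTheory/Rogawski1990/ArchDeltaTransferCentralVanishing.lean`, p841993; the R3 STEP-3 DAG ★: 3D p841544 · 3R p841630∕p841644 · 3H p841674∕p841703 · 3A′ p841779 ·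
(β₀) p841820 · 3G p841608 · 3G♭ p841730 + `ArchEndoscopicCentralCurveOrbitalSmooth` · 3T-b p841859 · (α) p841818 · (β) p841876 · (γ) p841993).  ONE stub remains: `stub_SdCanonical` (R4; census
`F0/P3a/F0P3a-p03/g10/CENSUS-R4-CentreWallRegular.F0P3a-p03g10.md` c3af6e58; R5 pay-down of record ★ p841718 `archCentralValueTransferExists_canonical_of_diagonal`).  Every other byte of ED. 1
(bfe2fc667750a518) is unchanged.

EDITION 3 («SdCanonical PAID DOWN TO THE LETTER», F0P3a-p03 (g11), LEAD WORDS T8-121 (ii) ∕ T8-135 ∕ T9-3; design census `CENSUS-SdArch-ED3-Design` 7141d221, N5 census 783c9612):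
`stub_SdCanonical` is no longer `sorry` — its body is ★ `archCentralValueTransferExists_canonical_of_letter stub_ArchCentralLimitU21` (`Rogawski1990/ArchCentralValueTransferDiagonalOfLetter.lean`,
p842658: the TWO-SIDED RANK-2 DESCENT OVER PLACES — N2 ★ p842193∕p842290 (the definite places, in-house) · N3-b∕N3-c ★ p842413∕`ArchStableClassTorusHaarSum` (p02) · N4 ★ p842421∕p842449
(A-p14∕A-p13) · N5 ★ p842447∕p842471 (p03) + ★ `ArchCentralDescentRankTwoFamily`∕`ArchCentralDescentBookkeeping`∕`ArchCentralLimitFunctionalEngine` (p06) · N6 ★ p842589∕p842658 (p03) + kit ★ p842630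
(p02 g12) + ★ `ArchCentralLimitRegularFilter` (p06) · N7 ★ p842255∕p842285 (p06) · R5 ★ p841718).  THE ONE NEW REGISTERED STUB is the (L_{U(2,1)}) LETTER BY NAME:
`stub_ArchCentralLimitU21 : ∀ L α w, ArchCentralLimitFormulaRankTwo L α w` (★ p842205, F0P3a-p02 (g11): Harish-Chandra's limit formula at the centre of the compact Cartan of `U(2,1)`,
Rogawski p. 126 L8–L13, [H₂] Lemmas 17.5∕27.5 — printed-hard, floor 2; in-house ROAD A (A1′)–(A5), owner p05 lineage).  Every other byte of ED. 2 (7443227ffe14e255) is unchanged.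

EDITION 4 («THE LETTER PAID DOWN TO (A6) + W6-core», F0P3a-p02 (g13), pen; ROAD A owner F0P3a-p05 (g14) MEMO R-14.5, LEAD WORD T9-30; by-import CERT v3
`F0/P3a/F0P3a-p02/g13/CERT-N1-EndState.v3.byimport.F0P3a-p02g13.lean`): `stub_ArchCentralLimitU21` is no longer `sorry` — its body is
`archCentralLimitFormulaRankTwo_of_ppm (fun L₀ _ _ _ α₀ w₀ h0 h1 h2 => ArchCentralLimitFormulaRankTwo.of_cornerRegularity_of_wallValues_min (mul_neg_of_pos_of_neg h0 h2) (stub_A6 L₀ α₀ w₀)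
(cornerValue_min_of_core L₀ α₀ w₀ h0 h1 h2 stub_W6core) (wall02_cubeLimit L₀ α₀ w₀ (mul_neg_of_pos_of_neg h0 h2)))` over ★ FILE A (G-perm) p843984 · FILE B p844011 · FILE C p844012 · FILE A′ p844106 ·
(o4) p844274 · (o4′) p844486 (F0P3a-p02) · (G′) p844336 · Z1–Z5 p843006…p844137 (A-p18) · (A4)-I∕-R∕(A3)-t p843372∕p843405∕p843448 · the chart engine ★ p843337∕p843581∕p843606∕p843638∕p843991 (p05, A-p14).
THE TWO NEW REGISTERED STUBS: `stub_A6 : ∀ L α w, ArchCentralLimitCornerRegularity L α w` (★ def p843483 — (A6) CORNER REGULARITY of `ρ′Δ·Φ_Θ` on the six chambers at `ζ•1`: Harish-Chandra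
[HARRG1] §17 Lemma 17.5 ∕ Thm. 17.1 — PRINTED-HARD, floor 2; in-house design `DESIGN-A6-InHouse` (p05), priced not staffed) and `stub_W6core : <hcore>` (the ball-model VALUE for `K`-invariant
test functions in the chart tokens of ★ `exists_wallGerm_psi`∕`exists_wallGerm_chi` — IN-HOUSE, W6 of ROAD A, owner F0P3a-p06 lineage; NOT print).  Every other byte of ED. 3 is unchanged.

EDITION 5 («W6-core PAID — SORRY-FREE AT W6», F0P3a-p02 (g14), pen; LEAD WORD T10-27 close-out lane; ROAD A owner F0P3a-p05 (g14) R-14.10∕R-14.11): `stub_W6core` is no longer `sorry` — its body is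
★ `Literature.Geometry.ComplexHyperbolic.BallModel.ballCore_of_rayIdentity Literature.Geometry.ComplexHyperbolic.BallModel.rayIdentity_of_total` (W6-FINAL ★ p845507: `hcore` ⟸ the pointwise ray identity, over ★ (w5) p844657 + ★ p05∕A-p14 one-sided jets +
★ p06 radial engine p844480; the ray identity ★ p846302 over ★ p06 TOTAL `centreValue_assembly_total` p845494 + ★ p09 (g0) token bridges); statement byte-identical.  Open stubs of this line 2 → 1
(`stub_A6`, PRINTED-HARD floor 2 — Harish-Chandra [HARRG1] §17 L. 17.5; books #179); books #180 «W6-core» ↦ CLOSED-DERIVED.  Every other byte of ED. 4 (8a56a69d391ee8c5) is unchanged (+2 imports, this paragraph, one docstring, one body).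

EDITION 6 («A6-lim PAID — THE MIRROR LINE IS SORRY-FREE», F0P3a-p09 (g3), pen by lineage; LEAD F0P3a-plan (g12) RULING T11-29 (the sorried «A6 ↦ A6-lim» candidate eb61cc17e95d4b20 of
F0P3a-p09 (g2) is SUPERSEDED before write; this edition is written BY WRITE after closer ED. 36 «A6-lim ⟸ ∅» is RE-REGISTERED, in the ORDER ED. 35 → TieED35 → ED. 36 → TieED36 → SdArch ED. 6);
ROAD A owner F0P3a-p05 (g15)): the ONE print input of ED. 5, (A6) `stub_A6 : ∀ L α w, ArchCentralLimitCornerRegularity L α w` (C³ corner EXTENSIONS of `F_Θ∘chart` — Harish-Chandra's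
boundary-regularity theorem [HARRG1] §17 L. 17.5, books #179) is OUT; IN its place, mirroring the closer's row `stub_A6lim` token for token, stands (A6-lim) `stub_A6lim : ∀ L α w, ArchCentralLimitExists L α w`
(★ def p846449 = the CONTINUITY half of Rogawski's sentence p. 126 L13, «`ω[ρ(γ)′Δ(γ)Φ_G(γ,f)]` is continuous at `γ₀`», in the letter's own tokens) — and it is NOT `sorry` but **DERIVED**: its body is the ★ term
`archCentralLimitExists_of_liePhiJetBounds liePhi_chamberJetBounds` (★ p846672 `Rogawski1990/ArchCentralLimitCornerRegularityOfJetBounds`, F0P3a-p09 (g2) ∘ ★ p846680 `Geometry/ComplexHyperbolic/UnitBallLieAlgebraChamberJets`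
(d2) FILE 3b, F0P3a-p05 (g15): Harish-Chandra's chamber jet bounds `hball` for `liePhi μ f` — IN-HOUSE over ★ (d2) FILE 2 p846671 `UnitBallLieAlgebraHCDictionary` ∕ ★ FILE 3a p846634 `LineIntegrationBootstrapWeylChambers` ∕ ★ p846595 `UnitBallLieAlgebraHCClosure` ∕ ★ (c3′) p846653 ∕ ★ (f1) p846633 —
then ★ Whitney on closed convex sets `WhitneyExtensionConvex_holds` + ★ `exists_contDiffOn_closure_of_bounded_iteratedFDeriv` give (A6) at every e-pattern frame, the ED. 5 body gives the letter at every frame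
(★ `archCentralLimitFormulaRankTwo_of_ppm` ∘ ★ `of_cornerRegularity_of_wallValues_min` ∘ ★ `cornerValue_min_of_core (ballCore_of_rayIdentity rayIdentity_of_total)` ∘ ★ `wall02_cubeLimit`), and
★ `ArchCentralLimitExists.of_rankTwo` its continuity half) — the same ★ term as the closer's `Kit.a6lim_of_jets` (ED. 36).  `stub_ArchCentralLimitU21 := archCentralLimitFormulaRankTwo_of_archCentralLimitExists_of_core
stub_A6lim stub_W6core` (★ p846458, F0P3a-p09 (g2): the letter from (A6-lim) + the W6-core value; statement byte-identical), mirroring the closer's `stub_L21 := Kit.l21_of_A6lim stub_A6lim`.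
OPEN STUBS OF THIS LINE 1 → 0: ALL FOUR `stub_*` (`stub_ScCore` ED. 2, `stub_A6lim` ED. 6, `stub_W6core` ED. 5, `stub_ArchCentralLimitU21` ED. 4∕6 ⟹ `stub_SdCanonical` ED. 3) AND BOTH `_of` ASSEMBLIES ARE
SORRY-FREE THEOREMS over ★ Literature, axioms ⊆ {propext, Classical.choice, Quot.sound}; books #179 «(A6-lim)» ↦ CLOSED ★ IN-HOUSE (LEAD T11-29: UNPROVED 20 → 19).  Versus ED. 5 (cb9c2f4da3b73761):
imports 5–7 (★ p844336 ∕ p844486 ∕ p844137, now reached through p846672) ↦ the three ★ imports p846458 ∕ p846672 ∕ p846680; this paragraph + the HONEST LABEL; `stub_A6` ↦ `stub_A6lim` (docstring,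
name, statement, body); `stub_ArchCentralLimitU21`'s docstring + body.  The statements of `stub_ScCore`, `stub_W6core`, `stub_ArchCentralLimitU21`, `stub_SdCanonical` and both `_of` assemblies are byte-identical to ED. 5.

HONEST LABEL: HC_CM is proved only modulo the printed citations until rung 0 closes; this line is the archimedean MIRROR of the closer's ROAD-Sd rows and, as of ED. 6, contains NO `sorry`:
`stub_ScCore` is PROVED (ED. 2, ★ p841993), `stub_W6core` is PROVED (ED. 5, ★ p845507 ∘ ★ p846302), `stub_A6lim` is PROVED (ED. 6, ★ p846672 ∘ ★ p846680), `stub_ArchCentralLimitU21` is PROVED from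
those two (★ p846458) and `stub_SdCanonical` from it (ED. 3, ★ p842658); the two `_of` theorems are sorry-free plumbing concluding the closer's rows (S-c) ∕ (S-d) BY NAME — so NOTHING archimedean
stands between the tree and those rows (the (S-c) row is separately CLOSED in Literature by ★ `archTransfersSingularOfCanonicalClosed_of_centralVanishing`, LINK 2).  What HC_CM still owes is
elsewhere: the closer's remaining registered print rows (finite places, (ST), the spectral side) — this file pays none of them and claims none.

* `stub_ScCore` = (S-c) PROPER [Rogawski1990 Lemma 14.5.2 (c), proof p. 238]: for every thirteen-conjunct system `(m′, m, mH, t′, t, tH)` at a frame (texts of ★ `ArchTransfersExistCanonical` VERBATIM, sliced from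
  the tree by script) and print's ray ∕ place binders of ★ `ArchTransfersSingularOfCanonical`, the central VANISHING `aH(ζ•1 ⊗ 1) = 0` of every smooth `Δ′_∞`-pair (the :228–:239 conjunct of ★ #77-s VERBATIM).
  Residual R3 of the LEDGER (in-house M–L now that ★ (R1G) p840661 gives HC's rank-one limit formula at a central point; joint = the torus-angle currency on `H_∞`), on diagonal carriers after R5 ((T-d) ★ 1–5).
* `stub_SdCanonical` = (S-d) ON THE CANONICAL FRAMES (hermitian, anisotropic, a definite place, non-degenerate factor): `ArchCentralValueTransferExists L H′ T ν′ νH`.  Residual R4 (printed-hard, floor 2: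
  HC's limit formula at the centre of `U(2,1)`∕`U(3)` with matched constants [§8.4 pp. 126–127]) + R5; by the ★ ray family ONE Weyl-normalised reference pair per `(L, H′)` suffices.
* `archTransfersSingularOfCanonicalClosed_of : ArchTransfersSingularOfCanonicalClosed` (= `stub_Sc`'s statement BY NAME) from `stub_ScCore` + the `hSd` binder (plumbing: the same ∃-witnesses,
  the thirteen conjuncts carried, (S-c) from the stub, (S-d) = `hSd` at the system).
* `archCentralValueTransferExistsClosed_of : ArchCentralValueTransferExistsClosed` (= `stub_Sd`'s statement BY NAME) from `stub_SdCanonical` + the ★ vacuous frames (`by_cases` on the three guards and (iv)).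
(ST-∞) is NOT a stub here: it lives inside the closer's HYPOTHESIS `hSET` (#88's pay-down line; its residuals R1∕R2 are recorded in the LEDGER for that desk).
-/

set_option autoImplicit false

noncomputable section

open MeasureTheory NumberField NumberField.InfinitePlace IsDedekindDomain
open Literature.MeasureTheory.Group Literature.NumberTheory.Rogawski1990 Literature.NumberTheory.Automorphic Literature.NumberTheory.GaloisRepresentations
open Literature.AlgebraicGeometry.ShimuraVarieties (unitaryGroup hermForm)
open scoped Matrix ComplexOrder

namespace Summit.HodgeConjecture.HodgeConjecture.Cruxes.H413.Lines.F0_P3a_SdArch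

/-- STUB (S-c) CORE — PAID (ED. 2) by ★ `archDeltaTransfer_apply_center_eq_zero` (p841993): Lemma 14.5.2 (c) at `∞` for the witnesses of a thirteen-conjunct system — the
`Δ′_∞`-transfer `aH` of a smooth `a′` VANISHES at the rational central elements of `H_∞` with central image (residual R3 of `LEDGER-ROAD-Sd.v2`: compact place from `hP` ⇒ `D_G·Φ → 0`
[p. 238] + the ray `hT` + HC's limit formula at the centre of `H_∞` — ★ (R1G) per indefinite block).  Statement byte-identical to ED. 1.
[cite: Rogawski1990, §14.5 Lemma 14.5.2 (c) p. 238; §8.4] [cite: Shelstad1979, Thm. 4.7] -/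
theorem stub_ScCore :
  ∀ (L : Type) [Field L] [NumberField L] [IsCMField L] (H' : Matrix (Fin 3) (Fin 3) L) (T : ArchTransferFactor L H')
  [MeasurableSpace (UnitaryGroup.arch (↥(maximalRealSubfield L)) L (IsCMField.complexConj L) 3 H')]
  [BorelSpace (UnitaryGroup.arch (↥(maximalRealSubfield L)) L (IsCMField.complexConj L) 3 H')]
  [MeasurableSpace (UnitaryGroup.arch (↥(maximalRealSubfield L)) L (IsCMField.complexConj L) 3
    (Matrix.of fun i j : Fin 3 => if i.val + j.val + 1 = 3 then (1 : L) else 0))]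
  [BorelSpace (UnitaryGroup.arch (↥(maximalRealSubfield L)) L (IsCMField.complexConj L) 3
    (Matrix.of fun i j : Fin 3 => if i.val + j.val + 1 = 3 then (1 : L) else 0))]
  [MeasurableSpace (UnitaryGroup.arch (↥(maximalRealSubfield L)) L (IsCMField.complexConj L) 2
          (Matrix.of fun i j : Fin 2 => if i.val + j.val + 1 = 2 then (1 : L) else 0) ×
        UnitaryGroup.arch (↥(maximalRealSubfield L)) L (IsCMField.complexConj L) 1
          (Matrix.of fun i j : Fin 1 => if i.val + j.val + 1 = 1 then (1 : L) else 0))]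
  [BorelSpace (UnitaryGroup.arch (↥(maximalRealSubfield L)) L (IsCMField.complexConj L) 2
          (Matrix.of fun i j : Fin 2 => if i.val + j.val + 1 = 2 then (1 : L) else 0) ×
        UnitaryGroup.arch (↥(maximalRealSubfield L)) L (IsCMField.complexConj L) 1
          (Matrix.of fun i j : Fin 1 => if i.val + j.val + 1 = 1 then (1 : L) else 0))]
  (ν' : Measure (UnitaryGroup.arch (↥(maximalRealSubfield L)) L (IsCMField.complexConj L) 3 H'))
  (ν : Measure (UnitaryGroup.arch (↥(maximalRealSubfield L)) L (IsCMField.complexConj L) 3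
    (Matrix.of fun i j : Fin 3 => if i.val + j.val + 1 = 3 then (1 : L) else 0)))
  (νH : Measure (UnitaryGroup.arch (↥(maximalRealSubfield L)) L (IsCMField.complexConj L) 2
          (Matrix.of fun i j : Fin 2 => if i.val + j.val + 1 = 2 then (1 : L) else 0) ×
        UnitaryGroup.arch (↥(maximalRealSubfield L)) L (IsCMField.complexConj L) 1
          (Matrix.of fun i j : Fin 1 => if i.val + j.val + 1 = 1 then (1 : L) else 0)))
  [ν'.IsHaarMeasure] [ν'.IsMulRightInvariant] [ν.IsHaarMeasure] [ν.IsMulRightInvariant]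
  [νH.IsHaarMeasure] [νH.IsMulRightInvariant]
    (μω : HeckeCharacter L) (hμu : μω.IsUnitary)
      (hμω : ∀ x : ideleGroup ↥(maximalRealSubfield L), μω (AdeleRing.ideleBaseChange (↥(maximalRealSubfield L)) L x) = quadraticHeckeCharCM L x)
      (c : ℂ) (hc : c ≠ 0) (hT : ∀ a b, T.Δ a b = c * archExplicitDelta L H' a μω b)
      (hP : (H'.map (cmConjRingHom L)).transpose = H' → (∀ x : Fin 3 → L, hermForm (cmConjRingHom L) H' x x = 0 → x = 0) →
        ∃ w : {w : InfinitePlace L // IsComplex w}, (H'.map w.1.embedding).PosDef ∨ (-H'.map w.1.embedding).PosDef)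
    (hherm : (H'.map (cmConjRingHom L)).transpose = H') (hanis : ∀ x : Fin 3 → L, hermForm (cmConjRingHom L) H' x x = 0 → x = 0),
      letI : ∀ γ : UnitaryGroup.arch (↥(maximalRealSubfield L)) L (IsCMField.complexConj L) 3 H',
          MeasurableSpace (UnitaryGroup.arch (↥(maximalRealSubfield L)) L (IsCMField.complexConj L) 3 H' ⧸
            Subgroup.centralizer ({γ} : Set (UnitaryGroup.arch (↥(maximalRealSubfield L)) L (IsCMField.complexConj L) 3 H'))) :=
        fun _ => borel _
      haveI : ∀ γ : UnitaryGroup.arch (↥(maximalRealSubfield L)) L (IsCMField.complexConj L) 3 H',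
          BorelSpace (UnitaryGroup.arch (↥(maximalRealSubfield L)) L (IsCMField.complexConj L) 3 H' ⧸
            Subgroup.centralizer ({γ} : Set (UnitaryGroup.arch (↥(maximalRealSubfield L)) L (IsCMField.complexConj L) 3 H'))) :=
        fun _ => ⟨rfl⟩
      letI : ∀ γ : UnitaryGroup.arch (↥(maximalRealSubfield L)) L (IsCMField.complexConj L) 3
            (Matrix.of fun i j : Fin 3 => if i.val + j.val + 1 = 3 then (1 : L) else 0),
          MeasurableSpace (UnitaryGroup.arch (↥(maximalRealSubfield L)) L (IsCMField.complexConj L) 3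
              (Matrix.of fun i j : Fin 3 => if i.val + j.val + 1 = 3 then (1 : L) else 0) ⧸
            Subgroup.centralizer ({γ} : Set (UnitaryGroup.arch (↥(maximalRealSubfield L)) L (IsCMField.complexConj L) 3
              (Matrix.of fun i j : Fin 3 => if i.val + j.val + 1 = 3 then (1 : L) else 0)))) :=
        fun _ => borel _
      haveI : ∀ γ : UnitaryGroup.arch (↥(maximalRealSubfield L)) L (IsCMField.complexConj L) 3
            (Matrix.of fun i j : Fin 3 => if i.val + j.val + 1 = 3 then (1 : L) else 0),
          BorelSpace (UnitaryGroup.arch (↥(maximalRealSubfield L)) L (IsCMField.complexConj L) 3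
              (Matrix.of fun i j : Fin 3 => if i.val + j.val + 1 = 3 then (1 : L) else 0) ⧸
            Subgroup.centralizer ({γ} : Set (UnitaryGroup.arch (↥(maximalRealSubfield L)) L (IsCMField.complexConj L) 3
              (Matrix.of fun i j : Fin 3 => if i.val + j.val + 1 = 3 then (1 : L) else 0)))) :=
        fun _ => ⟨rfl⟩
      letI : ∀ a : (UnitaryGroup.arch (↥(maximalRealSubfield L)) L (IsCMField.complexConj L) 2
            (Matrix.of fun i j : Fin 2 => if i.val + j.val + 1 = 2 then (1 : L) else 0) ×
          UnitaryGroup.arch (↥(maximalRealSubfield L)) L (IsCMField.complexConj L) 1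
            (Matrix.of fun i j : Fin 1 => if i.val + j.val + 1 = 1 then (1 : L) else 0)),
          MeasurableSpace ((UnitaryGroup.arch (↥(maximalRealSubfield L)) L (IsCMField.complexConj L) 2
              (Matrix.of fun i j : Fin 2 => if i.val + j.val + 1 = 2 then (1 : L) else 0) ×
            UnitaryGroup.arch (↥(maximalRealSubfield L)) L (IsCMField.complexConj L) 1
              (Matrix.of fun i j : Fin 1 => if i.val + j.val + 1 = 1 then (1 : L) else 0)) ⧸
            Subgroup.centralizer ({a} : Set (UnitaryGroup.arch (↥(maximalRealSubfield L)) L (IsCMField.complexConj L) 2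
              (Matrix.of fun i j : Fin 2 => if i.val + j.val + 1 = 2 then (1 : L) else 0) ×
            UnitaryGroup.arch (↥(maximalRealSubfield L)) L (IsCMField.complexConj L) 1
              (Matrix.of fun i j : Fin 1 => if i.val + j.val + 1 = 1 then (1 : L) else 0)))) :=
        fun _ => borel _
      haveI : ∀ a : (UnitaryGroup.arch (↥(maximalRealSubfield L)) L (IsCMField.complexConj L) 2
            (Matrix.of fun i j : Fin 2 => if i.val + j.val + 1 = 2 then (1 : L) else 0) ×
          UnitaryGroup.arch (↥(maximalRealSubfield L)) L (IsCMField.complexConj L) 1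
            (Matrix.of fun i j : Fin 1 => if i.val + j.val + 1 = 1 then (1 : L) else 0)),
          BorelSpace ((UnitaryGroup.arch (↥(maximalRealSubfield L)) L (IsCMField.complexConj L) 2
              (Matrix.of fun i j : Fin 2 => if i.val + j.val + 1 = 2 then (1 : L) else 0) ×
            UnitaryGroup.arch (↥(maximalRealSubfield L)) L (IsCMField.complexConj L) 1
              (Matrix.of fun i j : Fin 1 => if i.val + j.val + 1 = 1 then (1 : L) else 0)) ⧸
            Subgroup.centralizer ({a} : Set (UnitaryGroup.arch (↥(maximalRealSubfield L)) L (IsCMField.complexConj L) 2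
              (Matrix.of fun i j : Fin 2 => if i.val + j.val + 1 = 2 then (1 : L) else 0) ×
            UnitaryGroup.arch (↥(maximalRealSubfield L)) L (IsCMField.complexConj L) 1
              (Matrix.of fun i j : Fin 1 => if i.val + j.val + 1 = 1 then (1 : L) else 0)))) :=
        fun _ => ⟨rfl⟩
      ∀ (m' : OrbitalMeasureFamily (UnitaryGroup.arch (↥(maximalRealSubfield L)) L (IsCMField.complexConj L) 3 H'))
        (m : OrbitalMeasureFamily (UnitaryGroup.arch (↥(maximalRealSubfield L)) L (IsCMField.complexConj L) 3
          (Matrix.of fun i j : Fin 3 => if i.val + j.val + 1 = 3 then (1 : L) else 0)))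
        (mH : OrbitalMeasureFamily (UnitaryGroup.arch (↥(maximalRealSubfield L)) L (IsCMField.complexConj L) 2
            (Matrix.of fun i j : Fin 2 => if i.val + j.val + 1 = 2 then (1 : L) else 0) ×
          UnitaryGroup.arch (↥(maximalRealSubfield L)) L (IsCMField.complexConj L) 1
            (Matrix.of fun i j : Fin 1 => if i.val + j.val + 1 = 1 then (1 : L) else 0)))
        (t' : ∀ γ' : UnitaryGroup.arch (↥(maximalRealSubfield L)) L (IsCMField.complexConj L) 3 H',
          Measure (Subgroup.centralizer ({γ'} : Set (UnitaryGroup.arch (↥(maximalRealSubfield L)) L (IsCMField.complexConj L) 3 H'))))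
        (t : ∀ γ : UnitaryGroup.arch (↥(maximalRealSubfield L)) L (IsCMField.complexConj L) 3
            (Matrix.of fun i j : Fin 3 => if i.val + j.val + 1 = 3 then (1 : L) else 0),
          Measure (Subgroup.centralizer ({γ} : Set (UnitaryGroup.arch (↥(maximalRealSubfield L)) L (IsCMField.complexConj L) 3
            (Matrix.of fun i j : Fin 3 => if i.val + j.val + 1 = 3 then (1 : L) else 0)))))
        (tH : ∀ γH : UnitaryGroup.arch (↥(maximalRealSubfield L)) L (IsCMField.complexConj L) 2
              (Matrix.of fun i j : Fin 2 => if i.val + j.val + 1 = 2 then (1 : L) else 0) ×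
            UnitaryGroup.arch (↥(maximalRealSubfield L)) L (IsCMField.complexConj L) 1
              (Matrix.of fun i j : Fin 1 => if i.val + j.val + 1 = 1 then (1 : L) else 0),
          Measure (Subgroup.centralizer ({γH} : Set (UnitaryGroup.arch (↥(maximalRealSubfield L)) L (IsCMField.complexConj L) 2
              (Matrix.of fun i j : Fin 2 => if i.val + j.val + 1 = 2 then (1 : L) else 0) ×
            UnitaryGroup.arch (↥(maximalRealSubfield L)) L (IsCMField.complexConj L) 1
              (Matrix.of fun i j : Fin 1 => if i.val + j.val + 1 = 1 then (1 : L) else 0))))),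
      (
        m'.IsAdmissibleOn (fun γ => IsRegularElt (γ.val : GL (Fin 3) (mixedEmbedding.mixedSpace L))) ∧
          m.IsAdmissibleOn (fun γ => IsRegularElt (γ.val : GL (Fin 3) (mixedEmbedding.mixedSpace L))) ∧
          mH.IsAdmissibleOn (IsArchGRegular L) ∧
          IsArchNondegenerate L H' T ∧
          IsArchInnerTransferExists L H' m' m (ArchSmooth L 3 H')
            (ArchSmooth L 3 (Matrix.of fun i j : Fin 3 => if i.val + j.val + 1 = 3 then (1 : L) else 0)) ∧
          IsArchDeltaTransferExists L H' T mH m' (ArchSmooth L 3 H') (ArchSmooth₂ L) ∧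
        m'.IsQuotientOf (fun γ => IsRegularElt (γ.val : GL (Fin 3) (mixedEmbedding.mixedSpace L))) ν' t' ∧
          m.IsQuotientOf (fun γ => IsRegularElt (γ.val : GL (Fin 3) (mixedEmbedding.mixedSpace L))) ν t ∧
          mH.IsQuotientOf (IsArchGRegular L) νH tH ∧
        (∀ (γ₁ γ₂ : UnitaryGroup.arch (↥(maximalRealSubfield L)) L (IsCMField.complexConj L) 3 H')
            (h₁ : IsRegularElt (γ₁.val : GL (Fin 3) (mixedEmbedding.mixedSpace L)))
            (hc : Corresponds (UnitaryGroup.conjMixed (↥(maximalRealSubfield L)) L (IsCMField.complexConj L))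
              (UnitaryGroup.archFormOf L 3 H') (UnitaryGroup.archFormOf L 3 H') γ₁ γ₂),
            Measure.map ⇑(UnitaryGroup.archStableCentralizerEquiv L (Godement.det_ne_zero_of_anisotropic L H' hanis)
              (Godement.det_ne_zero_of_anisotropic L H' hanis) hc h₁) (t' γ₁) = t' γ₂) ∧
        (∀ (γ₁ γ₂ : UnitaryGroup.arch (↥(maximalRealSubfield L)) L (IsCMField.complexConj L) 3
              (Matrix.of fun i j : Fin 3 => if i.val + j.val + 1 = 3 then (1 : L) else 0))
            (h₁ : IsRegularElt (γ₁.val : GL (Fin 3) (mixedEmbedding.mixedSpace L)))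
            (hc : Corresponds (UnitaryGroup.conjMixed (↥(maximalRealSubfield L)) L (IsCMField.complexConj L))
              (UnitaryGroup.archFormOf L 3 (Matrix.of fun i j : Fin 3 => if i.val + j.val + 1 = 3 then (1 : L) else 0))
              (UnitaryGroup.archFormOf L 3 (Matrix.of fun i j : Fin 3 => if i.val + j.val + 1 = 3 then (1 : L) else 0)) γ₁ γ₂),
            Measure.map ⇑(UnitaryGroup.archStableCentralizerEquiv L (UnitaryGroup.isUnit_antidiagOne_det L 3).ne_zero
              (UnitaryGroup.isUnit_antidiagOne_det L 3).ne_zero hc h₁) (t γ₁) = t γ₂) ∧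
        (∀ (γ' : UnitaryGroup.arch (↥(maximalRealSubfield L)) L (IsCMField.complexConj L) 3 H')
            (γ : UnitaryGroup.arch (↥(maximalRealSubfield L)) L (IsCMField.complexConj L) 3
              (Matrix.of fun i j : Fin 3 => if i.val + j.val + 1 = 3 then (1 : L) else 0))
            (h' : IsRegularElt (γ'.val : GL (Fin 3) (mixedEmbedding.mixedSpace L)))
            (hc : Corresponds (UnitaryGroup.conjMixed (↥(maximalRealSubfield L)) L (IsCMField.complexConj L))
              (UnitaryGroup.archFormOf L 3 H')
              (UnitaryGroup.archFormOf L 3 (Matrix.of fun i j : Fin 3 => if i.val + j.val + 1 = 3 then (1 : L) else 0)) γ' γ),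
            Measure.map ⇑(UnitaryGroup.archStableCentralizerEquiv L (Godement.det_ne_zero_of_anisotropic L H' hanis)
              (UnitaryGroup.isUnit_antidiagOne_det L 3).ne_zero hc h') (t' γ') = t γ) ∧
        (∀ γH : UnitaryGroup.arch (↥(maximalRealSubfield L)) L (IsCMField.complexConj L) 2
              (Matrix.of fun i j : Fin 2 => if i.val + j.val + 1 = 2 then (1 : L) else 0) ×
            UnitaryGroup.arch (↥(maximalRealSubfield L)) L (IsCMField.complexConj L) 1
              (Matrix.of fun i j : Fin 1 => if i.val + j.val + 1 = 1 then (1 : L) else 0),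
            IsArchGRegular L γH → Measure.map ⇑(endoEmbArchCentralizer L γH) (tH γH) = t (endoEmbArch L γH))
      ) →
        ∀ (aH : (UnitaryGroup.arch (↥(maximalRealSubfield L)) L (IsCMField.complexConj L) 2 (Matrix.of fun i j : Fin 2 => if i.val + j.val + 1 = 2 then (1 : L) else 0) ×
          UnitaryGroup.arch (↥(maximalRealSubfield L)) L (IsCMField.complexConj L) 1 (Matrix.of fun i j : Fin 1 => if i.val + j.val + 1 = 1 then (1 : L) else 0)) → ℂ)
            (a' : UnitaryGroup.arch (↥(maximalRealSubfield L)) L (IsCMField.complexConj L) 3 H' → ℂ),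
            ArchSmooth₂ L aH → ArchSmooth L 3 H' a' → IsArchDeltaTransfer L H' T mH m' aH a' →
            ∀ (γH : (UnitaryGroup.cmDatum L 2 (Matrix.of fun i j : Fin 2 => if i.val + j.val + 1 = 2 then (1 : L) else 0)).Rational ×
                (UnitaryGroup.cmDatum L 1 (Matrix.of fun i j : Fin 1 => if i.val + j.val + 1 = 1 then (1 : L) else 0)).Rational) (ζ : L),
              (((γH.1 : unitaryGroup (cmConjRingHom L) (Matrix.of fun i j : Fin 2 => if i.val + j.val + 1 = 2 then (1 : L) else 0)).val : GL (Fin 2) L) :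
                  Matrix (Fin 2) (Fin 2) L) = ζ • (1 : Matrix (Fin 2) (Fin 2) L) →
              (((γH.2 : unitaryGroup (cmConjRingHom L) (Matrix.of fun i j : Fin 1 => if i.val + j.val + 1 = 1 then (1 : L) else 0)).val : GL (Fin 1) L) :
                  Matrix (Fin 1) (Fin 1) L) = ζ • (1 : Matrix (Fin 1) (Fin 1) L) →
              aH (cmRationalToArch L 2 (Matrix.of fun i j : Fin 2 => if i.val + j.val + 1 = 2 then (1 : L) else 0) γH.1,
                  cmRationalToArch L 1 (Matrix.of fun i j : Fin 1 => if i.val + j.val + 1 = 1 then (1 : L) else 0) γH.2) = 0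
    :=
  archDeltaTransfer_apply_center_eq_zero

/-- STUB (A6-lim) — CONTINUITY OF `ω[ρ′Δ·Φ_G]` AT THE CENTRE — **DERIVED (ED. 6)** by the ★ term `archCentralLimitExists_of_liePhiJetBounds liePhi_chamberJetBounds` (★ p846672 ∘ ★ p846680 (d2) FILE 3b; the same ★ term
as the closer's `Kit.a6lim_of_jets`, ED. 36); the name `stub_A6lim` and the statement mirror the closer's row token for token (it replaces ED. 4∕5's `stub_A6 : ∀ L α w, ArchCentralLimitCornerRegularity L α w`):
for every smooth compactly supported `Θ` on `G_w ≅ U(2,1)` and every centre `ζ`, the letter's 8-ray functional `Λ₈[F_Θ]` HAS A LIMIT along the regular torus points at `ζ•1` (★ def `ArchCentralLimitExists`,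
p846449 — Rogawski p. 126 L13 first half VERBATIM, in the letter's tokens; [H₂] L. 17.5 as quoted by Rogawski).  IN-HOUSE ★: Harish-Chandra's chamber jet bounds for `liePhi μ f` (ROAD A (d2), owner
F0P3a-p05 (g15)) ⟹ (A6) at the e-pattern frames by ★ Whitney-convex + ★ the closure lemma ⟹ the letter by the ED. 5 body ⟹ its continuity half (★ `ArchCentralLimitExists.of_rankTwo`); books #179 CLOSED ★ IN-HOUSE.
[cite: Rogawski1990, §8.4 p. 126 L13] [cite: HarishChandra1975HARRG1, §17 Lemma 17.5] [cite: WarnerHASSLG2, Thm. 8.4.3.1; §8.5.1 Thm. 8.5.1.1] -/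
theorem stub_A6lim :
  ∀ (L : Type) [Field L] (α : Fin 3 → L) (w : {w : InfinitePlace L // IsComplex w}), ArchCentralLimitExists L α w :=
  archCentralLimitExists_of_liePhiJetBounds Literature.Geometry.ComplexHyperbolic.BallModel.liePhi_chamberJetBounds

open scoped Matrix.Norms.Operator in
/-- STUB W6-core — **PAID (ED. 5)** by ★ `ballCore_of_rayIdentity rayIdentity_of_total` (W6-FINAL ★ p845507 ∘ the pointwise ray identity ★ p846302); statement byte-identical to ED. 4 — THE BALL-MODEL VALUE FOR `K`-INVARIANT TEST FUNCTIONS (IN-HOUSE, ROAD A work package W6, p06∕p05∕A-p14∕A-p18∕p09∕p02 lineages — NOT print): for every Haar `μ` on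
`U(2,1)` one `c(μ) > 0` such that every smooth, ambiently compactly supported, `K`-conjugation-invariant `Θ` and every `ζ` admit `C²` wall germs `ψ, χ` given on `(0, δ)` by the ★ chart
identities `exists_wallGerm_psi` (F0P3a-p05) ∕ `exists_wallGerm_chi` (A-p14) with `−(2i∕3)ψ″(0⁺) − (i∕2)ψ(0) + (i∕12)χ″(0⁺) = −c·i·Θ(ζ•1)` (= ★ `ballWallValue_of_core`'s binder `hcore` VERBATIM).
[cite: Rogawski1990, §8.4 pp. 126–127, Prop. 8.4.1(b)] -/
theorem stub_W6core :
    ∀ (μ : Measure Literature.Geometry.ComplexHyperbolic.BallModel.U21) [μ.IsHaarMeasure],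
        ∃ c : ℝ, 0 < c ∧ ∀ (Θ : Matrix (Fin 3) (Fin 3) ℂ → ℂ), ContDiff ℝ (⊤ : ℕ∞) Θ → HasCompactSupport Θ →
          (∀ κ : Matrix (Fin 3) (Fin 3) ℂ, κ * κᴴ = 1 → κ * Literature.Geometry.ComplexHyperbolic.BallModel.J = Literature.Geometry.ComplexHyperbolic.BallModel.J * κ → ∀ X, Θ (κ * X * κᴴ) = Θ X) →
          ∀ ζ : Circle, ∃ (δ : ℝ) (ψ χ : ℝ → ℂ), 0 < δ ∧ δ ≤ 2 ∧ ContDiffOn ℝ 2 ψ (Set.Icc 0 δ) ∧ ContDiffOn ℝ 2 χ (Set.Icc 0 δ) ∧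
            (∀ t ∈ Set.Ioo 0 δ, (2 - 2 * Real.cos (3 * t)) • (∫ g, Θ (Literature.Geometry.ComplexHyperbolic.BallModel.mat (g * Literature.Geometry.ComplexHyperbolic.BallModel.mkU21 (Matrix.diagonal ![((ζ * Circle.exp t : Circle) : ℂ), ((ζ * Circle.exp t : Circle) : ℂ), ((ζ * Circle.exp (-2 * t) : Circle) : ℂ)]) (Literature.Geometry.ComplexHyperbolic.BallModel.diagonal_uuv_preserves (ζ * Circle.exp t) (ζ * Circle.exp (-2 * t))) * g⁻¹)) ∂μ) = ψ t) ∧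
            (∀ t ∈ Set.Ioo 0 δ, ‖((ζ * Circle.exp (-2 * t) : Circle) : ℂ) - ((ζ * Circle.exp t : Circle) : ℂ)‖ ^ 4 •
              iteratedDeriv 2 (fun y : ℝ => ∫ u : Literature.Geometry.ComplexHyperbolic.BallModel.U21, Θ (Literature.Geometry.ComplexHyperbolic.BallModel.mat u * Matrix.diagonal (fun k : Fin 3 => (((![ζ * Circle.exp t, ζ * Circle.exp t, ζ * Circle.exp (-2 * t)] : Fin 3 → Circle) k * Circle.exp (y * ((if k = (0 : Fin 3) then (1 : ℝ) else 0) - (if k = (1 : Fin 3) then (1 : ℝ) else 0))) : Circle) : ℂ)) * Literature.Geometry.ComplexHyperbolic.BallModel.mat u⁻¹) ∂μ) 0 = χ t) ∧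
            -(2 / 3) * Complex.I * iteratedDerivWithin 2 ψ (Set.Icc 0 δ) 0 - (1 / 2) * Complex.I * ψ 0 + (1 / 12) * Complex.I * iteratedDerivWithin 2 χ (Set.Icc 0 δ) 0 =
              -((c : ℂ) * Complex.I) * Θ ((ζ : ℂ) • (1 : Matrix (Fin 3) (Fin 3) ℂ)) :=
  Literature.Geometry.ComplexHyperbolic.BallModel.ballCore_of_rayIdentity Literature.Geometry.ComplexHyperbolic.BallModel.rayIdentity_of_total

open scoped Matrix.Norms.Operator in
/-- STUB (L_{U(2,1)}) — THE LETTER BY NAME (ED. 3 stub; ED. 4: PAID DOWN to `stub_A6` + `stub_W6core`; ED. 6: PROVED from the two DERIVED rows `stub_A6lim` (ED. 6) + `stub_W6core` (ED. 5), statement byte-identical): Harish-Chandra's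
limit formula at the centre of the compact Cartan of `G_w ≅ U(2,1)` in the (Ω) 8-ray shape, ★ `ArchCentralLimitFormulaRankTwo` (F0P3a-p02 (g11), p842205: `∃ c > 0, ∀ Θ …, Tendsto Λ (𝓝[T_reg] ζ•1) (𝓝 (−(c·i)·Θ(ζ•1)))`,
phase pinned, modulus free).  Body = ★ `archCentralLimitFormulaRankTwo_of_archCentralLimitExists_of_core` (p846458, F0P3a-p09 (g2)), mirroring the closer's `stub_L21 := Kit.l21_of_A6lim stub_A6lim`; sorry-free since ED. 6.
[cite: Rogawski1990, §8.4 p. 126 L8–L13; p. 127] [cite: Varadarajan1989, §6.4] -/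
theorem stub_ArchCentralLimitU21 :
  ∀ (L : Type) [Field L] (α : Fin 3 → L) (w : {w : InfinitePlace L // IsComplex w}), ArchCentralLimitFormulaRankTwo L α w :=
  archCentralLimitFormulaRankTwo_of_archCentralLimitExists_of_core stub_A6lim stub_W6core

/-- STUB (S-d) ON THE CANONICAL FRAMES — PAID (ED. 3) by ★ `archCentralValueTransferExists_canonical_of_letter stub_ArchCentralLimitU21` (p842658); statement byte-identical to ED. 1∕2 — the central-value letter `ArchCentralValueTransferExists L H′ T ν′ νH` where a thirteen-conjunct system can exist: `H′` `c`-hermitian and anisotropic with a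
definite complex place, `T` non-degenerate (residual R4 of `LEDGER-ROAD-Sd.v2`: HC's limit formula at the centre of `U(2,1)`∕`U(3)` with matched constants, at ONE Weyl-normalised reference pair per
`(L, H′)` by the ★ ray family; + R5 to sit on diagonal `H′`). [cite: Rogawski1990, §14.5 p. 239; §8.4 pp. 126–127; §1.7 p. 6] [cite: Shelstad1979, Thm. 4.7] -/
theorem stub_SdCanonical :
  ∀ (L : Type) [Field L] [NumberField L] [IsCMField L] (H' : Matrix (Fin 3) (Fin 3) L) (T : ArchTransferFactor L H')
  [MeasurableSpace (UnitaryGroup.arch (↥(maximalRealSubfield L)) L (IsCMField.complexConj L) 3 H')]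
  [BorelSpace (UnitaryGroup.arch (↥(maximalRealSubfield L)) L (IsCMField.complexConj L) 3 H')]
  [MeasurableSpace (UnitaryGroup.arch (↥(maximalRealSubfield L)) L (IsCMField.complexConj L) 3
    (Matrix.of fun i j : Fin 3 => if i.val + j.val + 1 = 3 then (1 : L) else 0))]
  [BorelSpace (UnitaryGroup.arch (↥(maximalRealSubfield L)) L (IsCMField.complexConj L) 3
    (Matrix.of fun i j : Fin 3 => if i.val + j.val + 1 = 3 then (1 : L) else 0))]
  [MeasurableSpace (UnitaryGroup.arch (↥(maximalRealSubfield L)) L (IsCMField.complexConj L) 2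
          (Matrix.of fun i j : Fin 2 => if i.val + j.val + 1 = 2 then (1 : L) else 0) ×
        UnitaryGroup.arch (↥(maximalRealSubfield L)) L (IsCMField.complexConj L) 1
          (Matrix.of fun i j : Fin 1 => if i.val + j.val + 1 = 1 then (1 : L) else 0))]
  [BorelSpace (UnitaryGroup.arch (↥(maximalRealSubfield L)) L (IsCMField.complexConj L) 2
          (Matrix.of fun i j : Fin 2 => if i.val + j.val + 1 = 2 then (1 : L) else 0) ×
        UnitaryGroup.arch (↥(maximalRealSubfield L)) L (IsCMField.complexConj L) 1
          (Matrix.of fun i j : Fin 1 => if i.val + j.val + 1 = 1 then (1 : L) else 0))]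
  (ν' : Measure (UnitaryGroup.arch (↥(maximalRealSubfield L)) L (IsCMField.complexConj L) 3 H'))
  (νH : Measure (UnitaryGroup.arch (↥(maximalRealSubfield L)) L (IsCMField.complexConj L) 2
          (Matrix.of fun i j : Fin 2 => if i.val + j.val + 1 = 2 then (1 : L) else 0) ×
        UnitaryGroup.arch (↥(maximalRealSubfield L)) L (IsCMField.complexConj L) 1
          (Matrix.of fun i j : Fin 1 => if i.val + j.val + 1 = 1 then (1 : L) else 0)))
  [ν'.IsHaarMeasure] [ν'.IsMulRightInvariant]
  [νH.IsHaarMeasure] [νH.IsMulRightInvariant],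
    (H'.map (cmConjRingHom L)).transpose = H' → (∀ x : Fin 3 → L, hermForm (cmConjRingHom L) H' x x = 0 → x = 0) →
    (∃ w : {w : InfinitePlace L // IsComplex w}, (H'.map w.1.embedding).PosDef ∨ (-H'.map w.1.embedding).PosDef) → IsArchNondegenerate L H' T →
    ArchCentralValueTransferExists L H' T ν' νH :=
  archCentralValueTransferExists_canonical_of_letter stub_ArchCentralLimitU21

/-- **`stub_Sd` BY NAME**: ★ `ArchCentralValueTransferExistsClosed` from `stub_SdCanonical` and the ★ vacuous frames (p06 (g9) `ArchCentralValueTransferExistsVacuous`: a failing guard or a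
degenerate factor admits no thirteen-conjunct system, and a right-invariant Haar measure on `G_∞` always exists). [cite: Rogawski1990, §14.5 p. 239; §1.7 p. 6] -/
theorem archCentralValueTransferExistsClosed_of : ArchCentralValueTransferExistsClosed := by
  intro L _ _ _ H' T _ _ _ _ _ _ ν' νH _ _ _ _
  by_cases hherm : (H'.map (cmConjRingHom L)).transpose = H'
  · by_cases hanis : ∀ x : Fin 3 → L, hermForm (cmConjRingHom L) H' x x = 0 → x = 0
    · by_cases hS₀ : ∃ w : {w : InfinitePlace L // IsComplex w}, (H'.map w.1.embedding).PosDef ∨ (-H'.map w.1.embedding).PosDef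
      · by_cases hnd : IsArchNondegenerate L H' T
        · exact stub_SdCanonical L H' T ν' νH hherm hanis hS₀ hnd
        · exact archCentralValueTransferExists_of_not_isArchNondegenerate L H' T ν' νH hnd
      · exact archCentralValueTransferExists_of_not_exists_posDef L H' T ν' νH hS₀
    · exact archCentralValueTransferExists_of_not_anisotropic L H' T ν' νH hanis
  · exact archCentralValueTransferExists_of_not_isHermitian L H' T ν' νH hherm

/-- **`stub_Sc` BY NAME**: ★ `ArchTransfersSingularOfCanonicalClosed` («#77 ⟹ #77-s behind the ray ∕ place ∕ (S-d) binders») from `stub_ScCore`: the ∃-witnesses of #77 are kept, its thirteen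
conjuncts carried, (S-c) is the stub at that system, (S-d) is the binder `hSd` at that system. [cite: Rogawski1990, §14.5 Lemma 14.5.2 (c) p. 238; p. 239] -/
theorem archTransfersSingularOfCanonicalClosed_of : ArchTransfersSingularOfCanonicalClosed := by
  intro L _ _ _ H' T _ _ _ _ _ _ ν' ν νH _ _ _ _ _ _ μω hμu hμω c hc hT hP hSd h77 hherm hanis
  obtain ⟨m', m, mH, t', t, tH, h1, h2, h3, h4, h5, h6, h7, h8, h9, h10, h11, h12, h13⟩ := h77 hherm hanis
  refine ⟨m', m, mH, t', t, tH, h1, h2, h3, h4, h5, h6, h7, h8, h9, h10, h11, h12, h13, ?_, ?_⟩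
  · exact stub_ScCore L H' T ν' ν νH μω hμu hμω c hc hT hP hherm hanis m' m mH t' t tH ⟨h1, h2, h3, h4, h5, h6, h7, h8, h9, h10, h11, h12, h13⟩
  · intro a' a ha' ha hrel γ₀ γ ζ hγ₀ hγ
    exact hSd hherm hanis (hP hherm hanis) m' m mH t' t tH ⟨h1, h2, h3, h4, h5, h6, h7, h8, h9, h10, h11, h12, h13⟩ a' a ha' ha hrel γ₀ γ ζ hγ₀ hγ

end Summit.HodgeConjecture.HodgeConjecture.Cruxes.H413.Lines.F0_P3a_SdArch

end
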